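import Summits.BirchSwinnertonDyer.BirchSwinnertonDyer.Theorems.GoldfeldAllTwistsTwoConverseTwinHalfTraceThreeModEightExportGalois
import Summits.BirchSwinnertonDyer.BirchSwinnertonDyer.Theorems.GoldfeldAllTwistsTwoConverseTwinQuarterTraceSignaturesPAlphaModFourAlpha
import HarnessLib

set_option linter.dupNamespace false -- namespace `…BirchSwinnertonDyer.BirchSwinnertonDyer…` is the cell's (D-0017 nested layout)
set_option autoImplicit false

/-!
# OBJECT A3⁺, file T2: `…QuarterTraceSignaturesPAlphaThreeModEightModFourAlpha` — the type-α χ_p package over `K[1]` at the lift **`σ̃_p`** for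
# **`q ≡ 3 (mod 8)`**: the `σ̃_p`-SIGNATURE FLIPS, `k • (σ̃_pR_p + R_p) = T` (C4/C7A, `q ≡ 7 (mod 8)`: `= O`)

Cell `bsd-goldfeld`, seat `bsd-goldfeld-s1p-c3x` (gen 17). READ-IN object A3⁺ = cells a31+ ∪ a35+ (type α, `q ≡ 3 (mod 8)`, `q > 3`, `(q/7) = −1`;
`p ≡ 1 (mod 4)`, `(−7/p) = +1`, `−7 ∉ 𝔽_p^{×4}`; `(p/q) = +1`), memo `HOME/A3PLUS-CHIZ-ALPHA.md`. TWIN of C7A-P's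
`…QuarterTraceSignaturesPAlphaModFourAlpha` (§1 `exists_chiPAlpha_dataK_modFourAlpha`, §2 `exists_chiP_package_alpha_L_modFourAlpha`): statements
letter-identical EXCEPT `hq8 : q % 8 = 7` ↦ **`hq8 : q % 8 = 3`** (+ `h3 : 3 < q` in §2, automatic for `q ≡ 7 (mod 8)`), THEOREM A″'s structure
export X3α-1 ↦ THEOREM A‴'s export T1 `exists_threeModEight_structure_galois` (the ONE flipped clause `Ψ′ + τ′Ψ′ = T`), and the signature
conclusion **`k • (σ̃R_p + R_p) = 0` ↦ `= T`**. MECHANISM: `σ̃_p` (`σ̃_pr_q = r_q`, `σ̃_pr_p = −r_p`) acts on the `K₂[1]`-points through `ψ = σ̃_pτ`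
(fixes `ℚ(s) = K₂`, negates `r_q`; genus transport = A‴'s involution `g`: `gΨ′ = Ψ′ + P_χ`, `Y_q + gY_q = T`) composed with `τ` (`τΨ′ = T − Ψ′` — NEW —,
`τY_q = T − Y_q`); with `R_p = (mM′)Ψ′ + (mm′)Y_q`, `M′P_χ = (2m′)Y_q + t′`: **`σ̃_pR_p + R_p = (mM′)•T − m•t′`**, and `k₀•(…) = (k₀mM′)•T = T`
(`k₀t′ = O`; `k₀, m, M′` odd: type α). This is the paper's bit `s_p(σ̃_p)`: `0` on the `q ≡ 7 (mod 8)` cells, `1` here (B4-SIGNATURES §2 re-run).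
`hA`/`har` = THEOREM A‴'s exported statements on `49a1^{(−2q)}` (discharged in T5 by `…threeModEight_of_print'` / `…threeModFour_of_print'`).
`--supports stmt-BirchSwinnertonDyer-20044` as a HELPER (rank axis). Theses-free; theorems only; no definition, no new fact, no `sorry`. Binders BY NAME
as in the source. FRONTIER-grade: twist-density-ZERO sub-family modulo named print; never distance-to-summit. HONEST FRAMING: items 19350 / 19140 / 20044
unchanged; BSD is not proved by any of this.
-/


noncomputable section

open scoped Classical IntermediateField

open WeierstrassCurve Literature.NumberTheory.EllipticCurves Literature.NumberTheory.EllipticCurves.ModularForms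
  Literature.NumberTheory.EllipticCurves.CaiShuTian2014 Literature.NumberTheory.EllipticCurves.CoatesLiTianZhai2015
  Literature.Computability.Cryptography.Hallgren2005

namespace Summit.BirchSwinnertonDyer.BirchSwinnertonDyer.Theorems.GoldfeldGoodTwists

-- the cell's point-group world over `K[1]` / `K₂[1]` / `ℂ` (F2b's, P2e′'s, T1's); file-local
attribute [local instance 2000] Classical.propDecidable

section ChiPAlpha
variable {K : Type} [Field K] [NumberField K] (ι : K →+* ℂ) [FiniteDimensional K (ringClassField K ι 1)]
  [IsGalois K (ringClassField K ι 1)] [NumberField (ringClassField K ι 1)]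

/-! ## §1 F2b's K-side at `q ≡ 3 (mod 8)`: complex conjugation, `s = √−2q`, the partner `Y₂`, F2a's relation -/

/-- **F2b's K-side data, `q ≡ 3 (mod 8)`** (twin of `exists_chiPAlpha_dataK_modFourAlpha`; its proof verbatim): complex conjugation `τ` of `K[1]` (`τr_q = −r_q`, `τs = −s`, `τ² = 1`), `s ∈ K[1]`
with `s² = −2q` and `s·r_p ∈ K`, the partner `Y₂ = (P₂)_{K[1]}` of `ℚ(s)` (fixed by `Stab(r_p)`, of infinite order), and F2a's relation
`M_p•P_p = (2m)•Y₂ + t_p` (`M_p, m` odd, `t_p` torsion). [cite: Gross1984, §§4–5] [cite: GrossLMS1991, Prop. 5.3] -/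
theorem exists_chiPAlpha_dataK_threeModEight_modFourAlpha (hCST : thm11_ringClassChar)
    (hGZ : ∀ (N : ℕ) [NeZero N] (W : WeierstrassCurve ℚ) (K : Type) [Field K] [NumberField K], gross_zagier N W K)
    (h44 : thm44_ord_two_LAlg) (hnew : exists_isNewformOf) (hBT : burungaleTian_analyticRank_eq_zero_of_selmerCorank_eq_zero_of_hasCM)
    (hBF : bsdTriple_of_hasCM_of_L_one_ne_zero) (hGZK : rank_eq_analyticRank_of_analyticRank_le_one)
    (hK : IsImaginaryQuadratic K) {q p : ℕ} (hq : q.Prime) (hq8 : q % 8 = 3) (hq7 : jacobiSym q 7 = -1)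
    [Fact p.Prime] (hp4 : p % 4 = 1) (hp7 : legendreSym p (-7) = 1) (hα : ¬ ∃ x : ZMod p, x ^ 4 = -7)
    (hdK : NumberField.discr K = -(8 * (q : ℤ) * p))
    (hA : ∀ (K₂ : Type) [Field K₂] [NumberField K₂], IsImaginaryQuadratic K₂ → NumberField.discr K₂ = -(8 * (q : ℤ)) →
      ∀ P : (cm7.baseChange K₂).toAffine.Point, IsHeegnerPoint 49 cm7 K₂ P → ¬ IsOfFinAddOrder P)
    (har : ∀ (W : WeierstrassCurve ℚ) [W.IsElliptic] (C : VariableChange ℚ),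
      C • W = cm7.quadraticTwist ((-2 * q : ℤ) : ℚ) → W.analyticRank = 1)
    (D₀ : ModularParametrizationData cm7 49) (hc : |D₀.c| = 1) (hw : cm7.rootNumber = 1)
    (h0 : ∃ h, D₀.cuspZeroPoint = Affine.Point.some 2 (-1) h)
    {β : ℤ} (d : KolyvaginHeegnerData D₀ β ι 1) {rq rp : ringClassField K ι 1}
    (hrq : (rq : ℂ) ^ 2 = -(q : ℂ)) (hrp : (rp : ℂ) ^ 2 = (p : ℂ)) :
    ∃ (τ : ringClassField K ι 1 ≃ₐ[ℚ] ringClassField K ι 1) (s : ringClassField K ι 1) (κ : K)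
      (H₂ : HeegnerDatum 49 (NumberField.discr (ℚ⟮s⟯ : IntermediateField ℚ (ringClassField K ι 1)))) (P₂ : (cm7.baseChange (ℚ⟮s⟯ : IntermediateField ℚ (ringClassField K ι 1))).toAffine.Point)
      (tp : (cm7.baseChange (ringClassField K ι 1)).toAffine.Point) (Mp m : ℤ),
      (∀ x : ringClassField K ι 1, ((τ x : ringClassField K ι 1) : ℂ) = starRingEnd ℂ x) ∧ τ s = -s ∧ τ rq = -rq ∧ τ * τ = 1 ∧
      (s : ℂ) ^ 2 = -(2 * (q : ℂ)) ∧ s * rp = algebraMap K (ringClassField K ι 1) κ ∧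
      Affine.Point.map ((ringClassField K ι 1).subtype.comp (algebraMap ℚ⟮s⟯ (ringClassField K ι 1))).toRatAlgHom P₂ =
        heegnerPointComplex D₀ H₂ ∧
      Odd Mp ∧ Odd m ∧ IsOfFinAddOrder tp ∧
      Mp • (∑ σ : ringClassField K ι 1 ≃ₐ[K] ringClassField K ι 1, (if σ rp = rp then (1 : ℤ) else -1) •
            Affine.Point.map (σ : ringClassField K ι 1 →ₐ[K] ringClassField K ι 1) d.y) =
        (2 * m) • Affine.Point.map (ℚ⟮s⟯).val P₂ + tp ∧
      ∀ σ : ringClassField K ι 1 ≃ₐ[K] ringClassField K ι 1, σ rp = rp →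
        Affine.Point.map (σ : ringClassField K ι 1 →ₐ[K] ringClassField K ι 1) (Affine.Point.map (ℚ⟮s⟯).val P₂) =
          Affine.Point.map (ℚ⟮s⟯).val P₂ := by
  haveI : (cm7.baseChange (ringClassField K ι 1)).IsElliptic := by rw [WeierstrassCurve.baseChange]; infer_instance
  haveI : cm7.IsGloballyMinimal := Summit.BirchSwinnertonDyer.Rank1Residual.X12.O11.RouteU.isGloballyMinimal_X049_eq
  have hp : p.Prime := Fact.out
  obtain ⟨hq4, hq2, -⟩ := mod_eight_eq_three_arith hq8
  have hrpK := sq_eq_algebraMap_natCast' (ι := ι) hrp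
  have hpL : (p : ringClassField K ι 1) ≠ 0 := by exact_mod_cast hp.ne_zero
  have hrp0 : rp ≠ 0 := by
    intro h; rw [h, zero_pow two_ne_zero, map_natCast] at hrpK
    exact hpL hrpK.symm
  set Pp : (cm7.baseChange (ringClassField K ι 1)).toAffine.Point :=
    ∑ σ : ringClassField K ι 1 ≃ₐ[K] ringClassField K ι 1, (if σ rp = rp then (1 : ℤ) else -1) •
      Affine.Point.map (σ : ringClassField K ι 1 →ₐ[K] ringClassField K ι 1) d.y with hPp
  ------------------------------------------------------------------ complex conjugation of `K[1]`; `s = √−2q`, `s·r_p ∈ K`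
  obtain ⟨τ, hτ⟩ := Summit.BirchSwinnertonDyer.Rank1Residual.X11b.RingClassConj.exists_conj_algEquiv hK ι one_ne_zero
  obtain ⟨s, κ, hs, hsr⟩ := exists_sqrt_neg_two_mul_of_sqrt ι hK hp hdK hrp
  have hτs : τ s = -s := by
    apply Subtype.ext
    show ((τ s : ringClassField K ι 1) : ℂ) = ((-s : ringClassField K ι 1) : ℂ)
    have hs' : (s : ℂ) ^ 2 = -((2 * q : ℝ) : ℂ) := by rw [hs]; push_cast; ring
    rw [hτ, conj_eq_neg_of_sq_eq_neg_of_pos (by have := hq.pos; positivity) hs']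
    simp
  have hτrq : τ rq = -rq := by
    apply Subtype.ext
    show ((τ rq : ringClassField K ι 1) : ℂ) = ((-rq : ringClassField K ι 1) : ℂ)
    rw [hτ, conj_eq_neg_of_sq_eq_neg hq hrq]
    simp
  have hττ : τ * τ = 1 := by
    refine AlgEquiv.ext fun x ↦ Subtype.ext ?_
    change ((τ (τ x) : ringClassField K ι 1) : ℂ) = (x : ℂ)
    rw [hτ, hτ, starRingEnd_self_apply]
  ------------------------------------------------------------------ the partner `Y₂ = y_{ℚ(√−2q)}`
  obtain ⟨H₂, P₂, hP₂, hfix, hanti⟩ := exists_partnerPoint_negTwoMulPrime ι hw hq hq2 hq7 conductorNorm_cm7 D₀ h0 hs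
  set Y₂ : (cm7.baseChange (ringClassField K ι 1)).toAffine.Point := Affine.Point.map (ℚ⟮s⟯).val P₂ with hY₂def
  have hY₂fix : ∀ σ : ringClassField K ι 1 ≃ₐ[K] ringClassField K ι 1, σ rp = rp →
      Affine.Point.map (σ : ringClassField K ι 1 →ₐ[K] ringClassField K ι 1) Y₂ = Y₂ := fun σ hσ ↦ by
    rw [← map_restrictScalars_eq (K := K) σ]
    exact hfix ((σ : ringClassField K ι 1 →ₐ[K] ringClassField K ι 1).restrictScalars ℚ) ((apply_sqrt_partner_of_mul_eq hsr hrp0 σ).1 hσ)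
  have hY₂neg : ∀ σ : ringClassField K ι 1 ≃ₐ[K] ringClassField K ι 1, σ rp = -rp →
      Affine.Point.map (σ : ringClassField K ι 1 →ₐ[K] ringClassField K ι 1) Y₂ = -Y₂ := fun σ hσ ↦ by
    rw [← map_restrictScalars_eq (K := K) σ]
    have h := hanti ((σ : ringClassField K ι 1 →ₐ[K] ringClassField K ι 1).restrictScalars ℚ) ((apply_sqrt_partner_of_mul_eq hsr hrp0 σ).2 hσ)
    exact (neg_eq_of_add_eq_zero_right h).symm
  have hK₂ := isImaginaryQuadratic_adjoin_sqrt_neg_two_mul ι hq hs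
  have hdK₂ := discr_adjoin_sqrt_neg_two_mul ι hq hq2 hs
  have hP₂nt : ¬ IsOfFinAddOrder P₂ := hA _ hK₂ hdK₂ P₂ ⟨D₀, H₂, _, hP₂⟩
  have hY₂nt : ¬ IsOfFinAddOrder Y₂ := by
    intro h
    apply hP₂nt
    obtain ⟨n, hn, hnX⟩ := (isOfFinAddOrder_iff_zsmul_eq_zero).mp h
    refine (isOfFinAddOrder_iff_zsmul_eq_zero).mpr ⟨n, hn, ?_⟩
    apply Affine.Point.map_injective (W' := cm7) (f := (ℚ⟮s⟯).val)
    rw [map_zsmul, ← hY₂def, hnX, map_zero]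
  ------------------------------------------------------------------ F2a: the α height ratio and the relation `M_p • P_p = (2m) • Y₂ + t_p`
  obtain ⟨x, hx0, hx2, hL0, hHR⟩ := exists_heightRatio_genusPoint_partnerP_negEightTwoPrimes_alpha_modFourAlpha hCST hGZ h44 hBT hBF hnew
    conductorNorm_cm7 D₀ hc hq hq4 hq7 hp4 hp7 hα har hK hdK ι d rp hrp _ hK₂ hdK₂ H₂ _ P₂ hP₂ (ℚ⟮s⟯).val
  rw [sum_S_eq_sum_algEquiv d] at hHR
  have hsumeq : (∑ σ : ringClassField K ι 1 ≃ₐ[K] ringClassField K ι 1, (if (σ.restrictScalars ℚ) rp = rp then (1 : ℤ) else -1) •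
      pointGalHom cm7 (ringClassField K ι 1) (σ.restrictScalars ℚ) d.y) = Pp :=
    Finset.sum_congr rfl fun σ _ ↦ by rw [← map_restrictScalars_eq (K := K) σ d.y]; rfl
  rw [hsumeq] at hHR
  obtain ⟨hV0, hT1⟩ := rank_inputs_chiP (K := K) hGZK hq hdK har
  obtain ⟨Mp, m, tp, hMp, hm, htp, hrel⟩ := exists_quarterTrace_relation_p_alpha hK hq hdK hrpK d.y Y₂ hY₂nt hY₂fix hY₂neg hx0 hx2
    hHR (hV0 hL0) hT1
  exact ⟨τ, s, κ, H₂, P₂, tp, Mp, m, hτ, hτs, hτrq, hττ, hs, hsr, hP₂, hMp, hm, htp, hrel, hY₂fix⟩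

/-! ## §2 The χ_p package over `K[1]` in type α, `q ≡ 3 (mod 8)`, with the FLIPPED `σ̃_p`-signature -/

set_option maxHeartbeats 400000 in -- one long assembly (§1 + T1 pulled back to `K[1]` + the genus transport X3b-1), the source's own budget line
/-- **The type-α `χ_p` package in `X₀(49)(K[1])` with its `σ̃_p`-signature, `q ≡ 3 (mod 8)`.** Setting and binders of C7A-P's
`exists_chiP_package_alpha_L_modFourAlpha` with `hq8 : q % 8 = 3`, `h3 : 3 < q`. CONCLUSION: ODD `M_p`, points `R_p, t_p ∈ X₀(49)(K[1])`
(`e_L R_p, e_L t_p ∈ B`, `t_p` torsion) with `M_p • P_p = 4 • R_p + t_p`, and for every `σ̃ ∈ Gal(K[1]/K)` with `σ̃r_q = r_q`, `σ̃r_p = −r_p` an ODD `k`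
with **`k • (σ̃R_p + R_p) = T`** (the flipped bit `s_p(σ̃_p) = 1`: `σ̃R_p + R_p = (mM′)•T − m•t′` from A‴'s `τΨ′ = T − Ψ′`).
[cite: Gross1984, §§4–5] [cite: GrossLMS1991, Prop. 5.3] [cite: CoatesLiTianZhai2015, Thm. 4.4 and (2.8)] [cite: Cox2013, §3.B Thm. 3.15 and §6.A Thm. 6.1] -/
theorem exists_chiP_package_alpha_L_threeModEight_modFourAlpha (hEta₀ : x049_x_sub_two_eq_etaQuotient) (hD : deuring_etaQuotient49_heegner_generates_conjPrime)
    (hEta : x049_heegner_norm_x_sub_two_not_mem) (hCST : thm11_ringClassChar)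
    (hGZ : ∀ (N : ℕ) [NeZero N] (W : WeierstrassCurve ℚ) (K : Type) [Field K] [NumberField K], gross_zagier N W K)
    (h12 : thm12_fullBSD_twist) (h44 : thm44_ord_two_LAlg) (h14 : thm14_rankOne_twist) (hS31 : bsdTriple_of_rank_le_one_of_conductor_lt)
    (hnew : exists_isNewformOf) (hBT : burungaleTian_analyticRank_eq_zero_of_selmerCorank_eq_zero_of_hasCM)
    (hBF : bsdTriple_of_hasCM_of_L_one_ne_zero) (hGZK : rank_eq_analyticRank_of_analyticRank_le_one)
    (hK : IsImaginaryQuadratic K) {q p : ℕ} (hq : q.Prime) (hq8 : q % 8 = 3) (h3 : 3 < q) (hq7 : jacobiSym q 7 = -1)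
    [Fact p.Prime] (hp4 : p % 4 = 1) (hp7 : legendreSym p (-7) = 1) (hα : ¬ ∃ x : ZMod p, x ^ 4 = -7)
    (hdK : NumberField.discr K = -(8 * (q : ℤ) * p))
    (hA : ∀ (K₂ : Type) [Field K₂] [NumberField K₂], IsImaginaryQuadratic K₂ → NumberField.discr K₂ = -(8 * (q : ℤ)) →
      ∀ P : (cm7.baseChange K₂).toAffine.Point, IsHeegnerPoint 49 cm7 K₂ P → ¬ IsOfFinAddOrder P)
    (har : ∀ (W : WeierstrassCurve ℚ) [W.IsElliptic] (C : VariableChange ℚ),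
      C • W = cm7.quadraticTwist ((-2 * q : ℤ) : ℚ) → W.analyticRank = 1)
    (D₀ : ModularParametrizationData cm7 49) (hc : |D₀.c| = 1) (hw : cm7.rootNumber = 1)
    (h0 : ∃ h, D₀.cuspZeroPoint = Affine.Point.some 2 (-1) h)
    {β : ℤ} (d : KolyvaginHeegnerData D₀ β ι 1) {rq rp : ringClassField K ι 1}
    (hrq : (rq : ℂ) ^ 2 = -(q : ℂ)) (hrp : (rp : ℂ) ^ 2 = (p : ℂ)) (B : AddSubgroup (cm7.baseChange ℂ).toAffine.Point) (S : Subfield ℂ)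
    (hBfix : ∀ P : (cm7.baseChange (ringClassField K ι 1)).toAffine.Point,
      (∀ σ : ringClassField K ι 1 ≃ₐ[K] ringClassField K ι 1, σ rq = rq → σ rp = rp →
        Affine.Point.map (σ : ringClassField K ι 1 →ₐ[K] ringClassField K ι 1) P = P) →
      Affine.Point.map (W' := cm7) (ringClassField K ι 1).subtype.toRatAlgHom P ∈ B)
    (hBS : ∀ (E : Type) [Field E] [CharZero E] (e : E →+* ℂ), e.fieldRange ≤ S →
      ∀ z : (cm7.baseChange E).toAffine.Point, Affine.Point.map (W' := cm7) e.toRatAlgHom z ∈ B)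
    (hSK : ∀ k : K, ι k ∈ S) (hSq : (rq : ℂ) ∈ S) (hSp : (rp : ℂ) ∈ S)
    (hBL : ∀ z ∈ B, ∃ P : (cm7.baseChange (ringClassField K ι 1)).toAffine.Point,
      Affine.Point.map (W' := cm7) (ringClassField K ι 1).subtype.toRatAlgHom P = z) :
    ∃ (Mp : ℤ) (Rp tp : (cm7.baseChange (ringClassField K ι 1)).toAffine.Point), Odd Mp ∧ IsOfFinAddOrder tp ∧
      Affine.Point.map (W' := cm7) (ringClassField K ι 1).subtype.toRatAlgHom Rp ∈ B ∧
      Affine.Point.map (W' := cm7) (ringClassField K ι 1).subtype.toRatAlgHom tp ∈ B ∧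
      Mp • (∑ σ : ringClassField K ι 1 ≃ₐ[K] ringClassField K ι 1, (if σ rp = rp then (1 : ℤ) else -1) •
            Affine.Point.map (σ : ringClassField K ι 1 →ₐ[K] ringClassField K ι 1) d.y) = (4 : ℤ) • Rp + tp ∧
      ∀ σ : ringClassField K ι 1 ≃ₐ[K] ringClassField K ι 1, σ rq = rq → σ rp = -rp →
        ∃ k : ℤ, Odd k ∧ k • (Affine.Point.map (σ : ringClassField K ι 1 →ₐ[K] ringClassField K ι 1) Rp + Rp) =
          Affine.Point.some 2 (-1) (nonsingular_cm7_baseChange_two_neg_one (ringClassField K ι 1)) := by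
  haveI : (cm7.baseChange (ringClassField K ι 1)).IsElliptic := by rw [WeierstrassCurve.baseChange]; infer_instance
  have hp : p.Prime := Fact.out
  obtain ⟨-, hq2, -⟩ := mod_eight_eq_three_arith hq8
  have hrpK := sq_eq_algebraMap_natCast' (ι := ι) hrp
  have hpL : (p : ringClassField K ι 1) ≠ 0 := by exact_mod_cast hp.ne_zero
  have hrp0 : rp ≠ 0 := by
    intro h; rw [h, zero_pow two_ne_zero, map_natCast] at hrpK
    exact hpL hrpK.symm
  have hrpC0 : (rp : ℂ) ≠ 0 := fun h ↦ hrp0 (Subtype.ext h)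
  ------------------------------------------------------------------ §1's data; abbreviations `e_L`, `T`, `Y₂`, `ι₂`
  obtain ⟨τ, s, κ, H₂, P₂, tp, Mp, m, hτ, hτs, hτrq, hττ, hs, hsr, hP₂, hMp, hm, htp, hrel, hY₂fix⟩ :=
    exists_chiPAlpha_dataK_threeModEight_modFourAlpha ι hCST hGZ h44 hnew hBT hBF hGZK hK hq hq8 hq7 hp4 hp7 hα hdK hA har D₀ hc hw h0 d hrq hrp
  set eL := Affine.Point.map (W' := cm7) (ringClassField K ι 1).subtype.toRatAlgHom with heL
  set TL : (cm7.baseChange (ringClassField K ι 1)).toAffine.Point := Affine.Point.some 2 (-1) (nonsingular_cm7_baseChange_two_neg_one (ringClassField K ι 1)) with hTL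
  have heLT : eL TL = Affine.Point.some 2 (-1) (nonsingular_cm7_baseChange_two_neg_one ℂ) := map_cm7_twoTorsion _
  set Y₂ : (cm7.baseChange (ringClassField K ι 1)).toAffine.Point := Affine.Point.map (ℚ⟮s⟯).val P₂ with hY₂def
  have hK₂ := isImaginaryQuadratic_adjoin_sqrt_neg_two_mul ι hq hs
  have hdK₂ := discr_adjoin_sqrt_neg_two_mul ι hq hq2 hs
  set ι₂ : (ℚ⟮s⟯ : IntermediateField ℚ (ringClassField K ι 1)) →+* ℂ := (ringClassField K ι 1).subtype.comp (algebraMap (ℚ⟮s⟯ : IntermediateField ℚ (ringClassField K ι 1)) (ringClassField K ι 1)) with hι₂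
  haveI := (finiteDimensional_and_isGalois_ringClassField hK₂ ι₂ one_ne_zero).1
  haveI := (finiteDimensional_and_isGalois_ringClassField hK₂ ι₂ one_ne_zero).2
  haveI : NumberField (ringClassField (ℚ⟮s⟯ : IntermediateField ℚ (ringClassField K ι 1)) ι₂ 1) := numberField_ringClassField hK₂ ι₂ one_ne_zero
  ------------------------------------------------------------------ T1: THEOREM A‴'s structure of `K₂` at `K₂[1]`, with Galois clauses (`Ψ′ + τ′Ψ′ = T`)
  obtain ⟨M', m', r₀, g, τ', ΨF, PχF, YqF, t', hM', hm', ⟨k₀, hk₀, hk₀t⟩, -, hr₀C, hg, hτ', hP₂rel, hχrel, hΨτ, hYτ, hΨfix, hYqfix,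
    hgΨ, hgY, hmem⟩ :=
    exists_threeModEight_structure_galois hEta₀ hD hEta hCST hGZ h12 h44 h14 hS31 hnew hq hq8 h3 hq7 hK₂ hdK₂ ι₂ D₀ hc H₂ P₂ hP₂ hrq
  -- `ℚ(s) ⊂ S` (`s = ι(κ)/r_p`): memberships of the structure points
  have hsS : (s : ℂ) ∈ S := by
    have e : (s : ℂ) * (rp : ℂ) = ι κ := by
      have h := congrArg (fun z : ringClassField K ι 1 ↦ (z : ℂ)) hsr
      simpa [coe_algebraMap_ringClassField] using h
    have e' : (s : ℂ) = ι κ * (rp : ℂ)⁻¹ := by rw [← e, mul_inv_cancel_right₀ hrpC0]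
    rw [e']
    exact S.mul_mem (hSK κ) (S.inv_mem hSp)
  have hQS : ∀ x : ℚ, ((algebraMap ℚ (ringClassField K ι 1) x : ringClassField K ι 1) : ℂ) ∈ S := fun x ↦ by
    rw [eq_ratCast, SubfieldClass.coe_ratCast]; exact SubfieldClass.ratCast_mem S x
  have hι₂S : ∀ x : (ℚ⟮s⟯ : IntermediateField ℚ (ringClassField K ι 1)), ι₂ x ∈ S := fun x ↦
    fieldRange_subtype_comp_algebraMap_adjoin_le (k := ℚ) s S hQS hsS (RingHom.mem_fieldRange.mpr ⟨x, rfl⟩)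
  obtain ⟨hΨB, hχB, hYqB, ht'B⟩ := hmem B S hSq hι₂S hBS
  -- `e_L Y₂ = 2 • e_F Ψ′ + e_F P_χ` (before `ι₂` is made opaque)
  have heY₂ : eL Y₂ = (2 : ℤ) • Affine.Point.map (W' := cm7) (ringClassField (ℚ⟮s⟯ : IntermediateField ℚ (ringClassField K ι 1)) ι₂ 1).subtype.toRatAlgHom ΨF +
      Affine.Point.map (W' := cm7) (ringClassField (ℚ⟮s⟯ : IntermediateField ℚ (ringClassField K ι 1)) ι₂ 1).subtype.toRatAlgHom PχF := by
    rw [← hP₂rel, ← hP₂, hY₂def, heL, Affine.Point.map_map]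
    cases P₂ <;> rfl
  have hιa : ∀ a : (ℚ⟮s⟯ : IntermediateField ℚ (ringClassField K ι 1)), ι₂ a = ((a : ringClassField K ι 1) : ℂ) := fun a ↦ rfl
  clear_value ι₂
  set eF := Affine.Point.map (W' := cm7) (ringClassField (ℚ⟮s⟯ : IntermediateField ℚ (ringClassField K ι 1)) ι₂ 1).subtype.toRatAlgHom with heF
  have hTF : eF (Affine.Point.some 2 (-1) (nonsingular_cm7_baseChange_two_neg_one (ringClassField (ℚ⟮s⟯ : IntermediateField ℚ (ringClassField K ι 1)) ι₂ 1))) = Affine.Point.some 2 (-1) (nonsingular_cm7_baseChange_two_neg_one ℂ) := map_cm7_twoTorsion _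
  have hinj : Function.Injective eL := fun a b h ↦
    Affine.Point.map_injective (W' := cm7) (f := (ringClassField K ι 1).subtype.toRatAlgHom) h
  ------------------------------------------------------------------ `K[1]`-preimages (range property `hBL`) and pulled-back relations
  obtain ⟨ΨLL, hΨLL⟩ := hBL _ hΨB
  obtain ⟨PχL, hPχL⟩ := hBL _ hχB
  obtain ⟨YqL, hYqL⟩ := hBL _ hYqB
  obtain ⟨t'L, ht'L⟩ := hBL _ ht'B
  have hY₂L : Y₂ = (2 : ℤ) • ΨLL + PχL := hinj (by simp only [map_add, map_zsmul, hΨLL, hPχL, heY₂])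
  have hχL : M' • PχL = (2 * m') • YqL + t'L := hinj (by
    have e := congrArg eF hχrel
    simp only [map_add, map_zsmul] at e
    simp only [map_add, map_zsmul, hPχL, hYqL, ht'L, e])
  have hk₀L : k₀ • t'L = 0 := hinj (by
    have e := congrArg eF hk₀t
    simp only [map_zsmul, map_zero] at e
    simp only [map_zsmul, map_zero, ht'L, e])
  have ht'Lt : IsOfFinAddOrder t'L := (isOfFinAddOrder_iff_zsmul_eq_zero).mpr ⟨k₀, fun h ↦ absurd (show Even k₀ from ⟨0, by rw [h, add_zero]⟩) (Int.not_even_iff_odd.mpr hk₀), hk₀L⟩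
  ------------------------------------------------------------------ the package: `M_p″ := M′M_p`, `R_p := (mM′)Ψ′ + (mm′)Y_q`, `t_p″ := (2m)t′ + M′t_p`
  obtain ⟨Rp, hRp⟩ : ∃ X : (cm7.baseChange (ringClassField K ι 1)).toAffine.Point, X = (m * M') • ΨLL + (m * m') • YqL := ⟨_, rfl⟩
  obtain ⟨tq, htq⟩ : ∃ X : (cm7.baseChange (ringClassField K ι 1)).toAffine.Point, X = (2 * m) • t'L + M' • tp := ⟨_, rfl⟩
  have hrel' : (M' * Mp) • (∑ σ : ringClassField K ι 1 ≃ₐ[K] ringClassField K ι 1, (if σ rp = rp then (1 : ℤ) else -1) •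
            Affine.Point.map (σ : ringClassField K ι 1 →ₐ[K] ringClassField K ι 1) d.y) = (4 : ℤ) • Rp + tq := by
    rw [mul_zsmul, hrel, hRp, htq, hY₂L]
    linear_combination (norm := module) (2 * m) • hχL
  have hY₂B : eL Y₂ ∈ B := hBfix Y₂ (fun σ _ h2 ↦ hY₂fix σ h2)
  have hPpB : eL (∑ σ : ringClassField K ι 1 ≃ₐ[K] ringClassField K ι 1, (if σ rp = rp then (1 : ℤ) else -1) •
            Affine.Point.map (σ : ringClassField K ι 1 →ₐ[K] ringClassField K ι 1) d.y) ∈ B :=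
    hBfix _ (fun σ _ h2 ↦ (isChiPoint_twistedSum (K := K) hrpK hrp0 d.y).1 σ h2)
  have htpB : eL tp ∈ B := by
    rw [eq_sub_of_add_eq' hrel.symm, map_sub, map_zsmul, map_zsmul]
    exact B.sub_mem (B.zsmul_mem hPpB _) (B.zsmul_mem hY₂B _)
  have hRpB : eL Rp ∈ B := by
    rw [hRp, map_add, map_zsmul, map_zsmul, hΨLL, hYqL]
    exact B.add_mem (B.zsmul_mem hΨB _) (B.zsmul_mem hYqB _)
  have htqB : eL tq ∈ B := by
    rw [htq, map_add, map_zsmul, map_zsmul, ht'L]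
    exact B.add_mem (B.zsmul_mem ht'B _) (B.zsmul_mem htpB _)
  have htq_t : IsOfFinAddOrder tq := by
    obtain ⟨a, ha, ha0⟩ := (isOfFinAddOrder_iff_zsmul_eq_zero).mp ht'Lt
    obtain ⟨b, hb, hb0⟩ := (isOfFinAddOrder_iff_zsmul_eq_zero).mp htp
    refine (isOfFinAddOrder_iff_zsmul_eq_zero).mpr ⟨a * b, mul_ne_zero ha hb, ?_⟩
    rw [htq, zsmul_add, smul_smul, smul_smul, show a * b * (2 * m) = (b * (2 * m)) * a by ring, show a * b * M' = (a * M') * b by ring,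
      mul_zsmul, ha0, zsmul_zero, mul_zsmul, hb0, zsmul_zero, add_zero]
  refine ⟨M' * Mp, Rp, tq, hM'.mul hMp, htq_t, hRpB, htqB, hrel', fun σ hσq hσp ↦ ⟨k₀, hk₀, ?_⟩⟩
  ------------------------------------------------------------------ the signature under `σ̃`: `ψ := σ̃τ` fixes `ℚ(s)`, negates `r_q`
  obtain ⟨ψ, hψ⟩ : ∃ ψ : ringClassField K ι 1 ≃ₐ[ℚ] ringClassField K ι 1, ψ = (σ.restrictScalars ℚ) * τ := ⟨_, rfl⟩
  have hτx : ∀ x : ringClassField K ι 1, τ (τ x) = x := fun x ↦ by rw [← AlgEquiv.mul_apply, hττ, AlgEquiv.one_apply]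
  have hψσ : ∀ X : (cm7.baseChange (ringClassField K ι 1)).toAffine.Point,
      Affine.Point.map (σ : ringClassField K ι 1 →ₐ[K] ringClassField K ι 1) X =
        Affine.Point.map (ψ : ringClassField K ι 1 →ₐ[ℚ] ringClassField K ι 1)
          (Affine.Point.map (τ : ringClassField K ι 1 →ₐ[ℚ] ringClassField K ι 1) X) := fun X ↦ by
    have e' : (σ : ringClassField K ι 1 →ₐ[K] ringClassField K ι 1).restrictScalars ℚ =
        (ψ : ringClassField K ι 1 →ₐ[ℚ] ringClassField K ι 1).comp (τ : ringClassField K ι 1 →ₐ[ℚ] ringClassField K ι 1) :=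
      AlgHom.ext fun x ↦ by
        change σ x = ψ (τ x)
        rw [hψ, AlgEquiv.mul_apply, AlgEquiv.restrictScalars_apply, hτx]
    rw [← map_restrictScalars_eq (K := K) σ, e', Affine.Point.map_map]
  have hψs : ψ s = s := by
    rw [hψ, AlgEquiv.mul_apply, hτs, map_neg, AlgEquiv.restrictScalars_apply, (apply_sqrt_partner_of_mul_eq hsr hrp0 σ).2 hσp, neg_neg]
  have hψrq : ψ rq = -rq := by
    rw [hψ, AlgEquiv.mul_apply, hτrq, map_neg, AlgEquiv.restrictScalars_apply, hσq]
  have hψF : ∀ a : (ℚ⟮s⟯ : IntermediateField ℚ (ringClassField K ι 1)), ψ (algebraMap _ (ringClassField K ι 1) a) = algebraMap _ (ringClassField K ι 1) a := fun a ↦ by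
    rw [IntermediateField.algebraMap_apply]
    exact apply_eq_self_of_mem_adjoin_simple ψ hψs a.2
  ------------------------------------------------------------------ genus transport (X3b-1): `ψ` acts on `Ψ′`, `Y_q` as `g`; `τ` as `τ′`
  have hcoe : ∀ a : (ℚ⟮s⟯ : IntermediateField ℚ (ringClassField K ι 1)), ((algebraMap _ (ringClassField (ℚ⟮s⟯ : IntermediateField ℚ (ringClassField K ι 1)) ι₂ 1) a : (ringClassField (ℚ⟮s⟯ : IntermediateField ℚ (ringClassField K ι 1)) ι₂ 1)) : ℂ) = ((algebraMap _ (ringClassField K ι 1) a : ringClassField K ι 1) : ℂ) :=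
    fun a ↦ by rw [coe_algebraMap_ringClassField, IntermediateField.algebraMap_apply]; exact hιa a
  have hr : (rq : ℂ) = (r₀ : ℂ) := hr₀C.symm
  have hψg : ((ψ rq : ringClassField K ι 1) : ℂ) = ((g r₀ : (ringClassField (ℚ⟮s⟯ : IntermediateField ℚ (ringClassField K ι 1)) ι₂ 1)) : ℂ) := by
    rw [hψrq, hg]; push_cast; rw [hr]
  have hTΨ : eL (Affine.Point.map (ψ : ringClassField K ι 1 →ₐ[ℚ] ringClassField K ι 1) ΨLL) =
      eF (Affine.Point.map (g : (ringClassField (ℚ⟮s⟯ : IntermediateField ℚ (ringClassField K ι 1)) ι₂ 1) →ₐ[ℚ⟮s⟯] (ringClassField (ℚ⟮s⟯ : IntermediateField ℚ (ringClassField K ι 1)) ι₂ 1)) ΨF) :=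
    map_subtype_map_eq_of_genusTransport ι _ (ringClassField (ℚ⟮s⟯ : IntermediateField ℚ (ringClassField K ι 1)) ι₂ 1) hcoe r₀ rq hr ψ hψF g hψg ΨF hΨfix ΨLL hΨLL
  have hTY : eL (Affine.Point.map (ψ : ringClassField K ι 1 →ₐ[ℚ] ringClassField K ι 1) YqL) =
      eF (Affine.Point.map (g : (ringClassField (ℚ⟮s⟯ : IntermediateField ℚ (ringClassField K ι 1)) ι₂ 1) →ₐ[ℚ⟮s⟯] (ringClassField (ℚ⟮s⟯ : IntermediateField ℚ (ringClassField K ι 1)) ι₂ 1)) YqF) :=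
    map_subtype_map_eq_of_genusTransport ι _ (ringClassField (ℚ⟮s⟯ : IntermediateField ℚ (ringClassField K ι 1)) ι₂ 1) hcoe r₀ rq hr ψ hψF g hψg YqF hYqfix YqL hYqL
  have hcL : ∀ X, eL (Affine.Point.map (τ : ringClassField K ι 1 →ₐ[ℚ] ringClassField K ι 1) X) =
      Affine.Point.map (W' := cm7) conjRatAlgHom (eL X) := map_subtype_map_conj_cm7 τ hτ
  have hcF : ∀ X, eF (Affine.Point.map (τ' : (ringClassField (ℚ⟮s⟯ : IntermediateField ℚ (ringClassField K ι 1)) ι₂ 1) →ₐ[ℚ] (ringClassField (ℚ⟮s⟯ : IntermediateField ℚ (ringClassField K ι 1)) ι₂ 1)) X) = Affine.Point.map (W' := cm7) conjRatAlgHom (eF X) :=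
    map_subtype_map_conj_cm7 τ' hτ'
  have hτ'Ψ : Affine.Point.map (τ' : (ringClassField (ℚ⟮s⟯ : IntermediateField ℚ (ringClassField K ι 1)) ι₂ 1) →ₐ[ℚ] (ringClassField (ℚ⟮s⟯ : IntermediateField ℚ (ringClassField K ι 1)) ι₂ 1)) ΨF = Affine.Point.some 2 (-1) (nonsingular_cm7_baseChange_two_neg_one (ringClassField (ℚ⟮s⟯ : IntermediateField ℚ (ringClassField K ι 1)) ι₂ 1)) - ΨF := eq_sub_of_add_eq' hΨτ
  have hτ'Y : Affine.Point.map (τ' : (ringClassField (ℚ⟮s⟯ : IntermediateField ℚ (ringClassField K ι 1)) ι₂ 1) →ₐ[ℚ] (ringClassField (ℚ⟮s⟯ : IntermediateField ℚ (ringClassField K ι 1)) ι₂ 1)) YqF = Affine.Point.some 2 (-1) (nonsingular_cm7_baseChange_two_neg_one (ringClassField (ℚ⟮s⟯ : IntermediateField ℚ (ringClassField K ι 1)) ι₂ 1)) - YqF := eq_sub_of_add_eq' hYτ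
  have hgY' : Affine.Point.map (g : (ringClassField (ℚ⟮s⟯ : IntermediateField ℚ (ringClassField K ι 1)) ι₂ 1) →ₐ[ℚ⟮s⟯] (ringClassField (ℚ⟮s⟯ : IntermediateField ℚ (ringClassField K ι 1)) ι₂ 1)) YqF = Affine.Point.some 2 (-1) (nonsingular_cm7_baseChange_two_neg_one (ringClassField (ℚ⟮s⟯ : IntermediateField ℚ (ringClassField K ι 1)) ι₂ 1)) - YqF := eq_sub_of_add_eq' hgY
  have hψΨ : Affine.Point.map (ψ : ringClassField K ι 1 →ₐ[ℚ] ringClassField K ι 1) ΨLL = ΨLL + PχL := hinj (by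
    rw [hTΨ, hgΨ]; simp only [map_add, hΨLL, hPχL])
  have hψY : Affine.Point.map (ψ : ringClassField K ι 1 →ₐ[ℚ] ringClassField K ι 1) YqL = TL - YqL := hinj (by
    rw [hTY, hgY']; simp only [map_sub, hTF, hYqL, heLT])
  have hτΨ : Affine.Point.map (τ : ringClassField K ι 1 →ₐ[ℚ] ringClassField K ι 1) ΨLL = TL - ΨLL := hinj (by
    rw [hcL, hΨLL, ← hcF, hτ'Ψ]; simp only [map_sub, hTF, hΨLL, heLT])
  have hτY : Affine.Point.map (τ : ringClassField K ι 1 →ₐ[ℚ] ringClassField K ι 1) YqL = TL - YqL := hinj (by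
    rw [hcL, hYqL, ← hcF, hτ'Y]; simp only [map_sub, hTF, hYqL, heLT])
  have hψT : Affine.Point.map (ψ : ringClassField K ι 1 →ₐ[ℚ] ringClassField K ι 1) TL = TL := by
    rw [hTL, Affine.Point.map_some]; congr 1
    · exact map_ofNat _ 2
    · simp only [map_neg, map_one]
  have hT2 : 2 • TL = 0 := by rw [two_nsmul]; exact cm7_twoTorsion_add_self _
  ------------------------------------------------------------------ `σ̃R_p + R_p = (mM′)•T − m•t′`: `t′` is killed by the odd `k₀`, `(k₀mM′)•T = T`
  have hfinal : Affine.Point.map (σ : ringClassField K ι 1 →ₐ[K] ringClassField K ι 1) Rp + Rp = (m * M') • TL - m • t'L := by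
    rw [hRp, map_add, map_zsmul, map_zsmul, hψσ, hψσ, hτΨ, hτY, map_sub, map_sub, hψΨ, hψT, hψY, eq_sub_of_add_eq' hχL.symm]
    module
  rw [hfinal, smul_sub, smul_comm k₀ m t'L, hk₀L, smul_zero, sub_zero, smul_smul]
  exact zsmul_twoTorsion_of_odd hT2 (hk₀.mul (hm.mul hM'))

end ChiPAlpha

end Summit.BirchSwinnertonDyer.BirchSwinnertonDyer.Theorems.GoldfeldGoodTwists

end
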